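import Summits.Ventures.PercRepro2.CaseOneStarCertT1
import Summits.Ventures.PercRepro2.CaseOneGadgetUWA1BBlockI0
import Summits.Ventures.PercRepro2.CaseOneGadgetUWA1BBlockI1
import Summits.Ventures.PercRepro2.CaseOneGadgetUWA1BBlockI2
import Summits.Ventures.PercRepro2.CaseOneGadgetUWA1BBlockI3
import Summits.Ventures.PercRepro2.CaseOneGadgetUWA1BBlockI4
import Summits.Ventures.PercRepro2.CaseOneGadgetUWA1BBlockI5
import Summits.Ventures.PercRepro2.CaseOneGadgetUWA1BBlockI6
import Summits.Ventures.PercRepro2.CaseOneGadgetUWA1BBlockI7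
import Summits.Ventures.PercRepro2.CaseOneGadgetUWA1BBlockI8
import Summits.Ventures.PercRepro2.CaseOneGadgetUWA1BBlockI9
import Summits.Ventures.PercRepro2.CaseOneGadgetUWA1BBlockI10
import Summits.Ventures.PercRepro2.CaseOneGadgetUWA1BBlockI11
import Summits.Ventures.PercRepro2.CaseOneGadgetUWA1BBlockI12
import Summits.Ventures.PercRepro2.CaseOneGadgetUWA1BBlockI13
import Summits.Ventures.PercRepro2.CaseOneGadgetUWA1BBlockI14
import Summits.Ventures.PercRepro2.CaseOneStarFactsB

/-!
# The gadget `u ~ {w, a₁, b}`, `w ~ {u, a₂, o}` (uwa1b): the cell certificates of `iAB5` (part 40b)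
(blind cell PercRepro2, p1 g34; the fourth gadget anchor of the six-form calculus — all six forms of the uwa1b gadget
as plain SFacts-cone certificate chains, generated by mining/p1/g34/uwa1b/genu.py = p1 g33's gent_uwa1.py / g25's
geno.py re-targeted; P1-G33 §6–§6″, P1-G34)

Each `eBABI ijk kl` is a nonnegative combination of `(pairwise atom) × (cell)` and cubic cell monomials — or, for the degree-4 ones, `M × eBABI ijk kl` (`M = Σ cᵢ` the total cell mass) is a nonnegative combination of `(atom) × (cell) × (cell)` and quartic cell monomials, then `SFacts.nonneg_of_sum_mul` (`CaseOneStarCertT1`) — exact LP certificates (kit j319447, every certificate re-verified exactly; data/p1/g33/gcerts_i_uwa1b.json, form `i`), here as exact `linear_combination`s over `SFacts` (the rational coefficients cleared by their common denominator). -/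

namespace Summit.Ventures.PercRepro2

namespace CaseOne

section CertABI40b
variable {R : Type*} [Field R] [LinearOrder R] [IsStrictOrderedRing R]

set_option maxHeartbeats 0 in
/-- `eBABI32223 ≥ 0`: the combination is identically zero (`ring`). -/
lemma eBABI32223_nonneg (m : SCells R) (_hf : SFactsB m) : 0 ≤ eBABI32223 m := by
  have h : eBABI32223 m = 0 := by
    unfold eBABI32223 cBABI00123 cBABI00223 cBABI01023 cBABI01123 cBABI01223 cBABI02023 cBABI02123 cBABI02223 cBABI10023 cBABI10123 cBABI10223 cBABI11023 cBABI11123 cBABI11223 cBABI12023 cBABI12123 cBABI12223 cBABI20023 cBABI20123 cBABI20223 cBABI21023 cBABI21123 cBABI21223 cBABI22023 cBABI22123 cBABI22223 cBABI30123 cBABI30223 cBABI31023 cBABI31123 cBABI31223 cBABI32023 cBABI32123 cBABI32223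
    ring
  linarith [h]

set_option maxHeartbeats 0 in
/-- `eBABI32230 ≥ 0`: the combination is identically zero (`ring`). -/
lemma eBABI32230_nonneg (m : SCells R) (_hf : SFactsB m) : 0 ≤ eBABI32230 m := by
  have h : eBABI32230 m = 0 := by
    unfold eBABI32230 cBABI00130 cBABI00230 cBABI01030 cBABI01130 cBABI01230 cBABI02030 cBABI02130 cBABI02230 cBABI10130 cBABI10230 cBABI11030 cBABI11130 cBABI11230 cBABI12030 cBABI12130 cBABI12230 cBABI20130 cBABI20230 cBABI21030 cBABI21130 cBABI21230 cBABI22030 cBABI22130 cBABI22230 cBABI31130 cBABI31230 cBABI32030 cBABI32130 cBABI32230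
    ring
  linarith [h]

end CertABI40b

end CaseOne

end Summit.Ventures.PercRepro2
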